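import Summits.QuantumFields.YangMills.Theorems.UnitScaleTiltProp7TransporterRowsOnBall
import Summits.QuantumFields.YangMills.Theorems.UnitScaleTiltProp7SolutionHessianSupAllMembers
import Summits.QuantumFields.YangMills.Theorems.UnitScaleTiltProp7LocalLaplacianGaugeCovariance
import Summits.QuantumFields.YangMills.Theorems.UnitScaleTiltProp7CurvedMemberLocalGradient
import HarnessLib

/-!
# Route `UnitScaleTilt`, crux K1 «MinimiserStabilityRegPr» (stmt-QuantumFields-19200), EX row (5) `h3` (STOREY H), pipeline (ii) := «H2-LOC» (★CHAIR WORD №60, ★★OWNER RULING №52 ∕ RECORD 17do),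
# brick **C6-PLUMBING: FROM LOCAL LETTERS AT THE MEMBER TO THE WINDOWED COVER-AXIAL ½-HÖLDER LETTER `hax`** (the display of BRIDGE v2 ✓∕⧗`Prop7AxialHolderBridge.hHωt_of_window` = H8-R′ v2's
# `hHωw`).  Three consumer-side conversions, generic in the member field:
# (P0) the letter is ADDITIVE in the field; (P1) a member equation `Δ^η_{U₀}u + q = D*_{U₀}f` with GLOBAL sup rows and the DISPLAYED LOCAL ½-Hölder letter `hHlocV` (px19 g16's FROZEN text
# `H2LOC-LETTER-hHlocV.px19g16.txt` sha16 857ccd79b0071bdc, ★★OWNER RECORD 17dq — byte-for-byte, applied at the cover member) give the letter for `u` — the equation LIFTS to the `L³`-fold cover (✓`covLapSite_cover`, ✓`DstarL2_cover'`) and is GAUGE COVARIANT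
# (✓`exists_adIsometries`), the cover's axial gauge at the centre is a small-field gauge on the `12ℓ+4` ball (pipeline (i) ✓`Prop7LocalAxialGaugeSmallField`), so the schema applies at every
# point of the `4ℓ+1` ball; (P2) a GLOBAL covariant η-gradient sup letter `‖(D_{U₀}p)(b)‖ ≤ G` and a sup `M_p` give the letter for `p` — stencil (3.3) ✓`equiv_DL2_apply`, the windowed
# transporter row ✓`Prop7TransporterRowsOnBall.hRε_axialGauge_cover`, and the lattice-path lemma ✓`Prop7CurvedMemberLocalGradient.holder_of_eta_gradient` on the cover.
# C6 proper (the knit `ω₁ = w − G′ᴾ(Bw) − G_a(T c(v′))`, memo §4) = (P0) over (P1) at `u := w` and (P2) at the pinned gradient letters.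

Cell `ym3-torus` (HUMAN RULING D-0037; rung R3 = SU(2) YM₃ on T³ — NOT d = 4, NOT infinite volume, NOT a mass gap, NOT Clay).  Width seat `ym3-torus-px13` (gen 17);
`--supports stmt-QuantumFields-19200 --as helper`; count-neutral; THEOREMS ONLY (0 `def`, 0 `sorry`, default heartbeats).

THE LETTER (BRIDGE v2 §3 `hax`, written out each time; member field `ω`, constant `H`): for every cover centre `ct` and `yt, yt′` with `tdist (ẽ ct) · ≤ 4ℓ+1`, `tdist yt yt′ ≤ ℓ`:
`‖T[ω](yt′) − T[ω](yt)‖ ≤ H·(tdist yt yt′∕ℓ)^{½}`, `T[ω] := toL2S (F.cover 3) (z̃ ↦ σ̃_ct(z̃)·ω♭(π z̃)·σ̃_ct(z̃)*)`, `σ̃_ct = axialT (U₀ ∘ π♭) ct`, `ω♭ = toL2S⁻¹ω`.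

WHAT IS PROVED (ns `Summit.QuantumFields.YangMills.Theorems.Prop7LocalHolderToAxialLetter`; member `F`, heights `n K`, weight `c₀ > 0`).
* §0 `transported_add`∕`transported_sub` (`T[ω₁ ± ω₂] = T[ω₁] ± T[ω₂]`), ★ `hax_add`, ★ `hax_sub` — (P0): letters `H₁, H₂` for `ω₁, ω₂` ⟹ `H₁ + H₂` for `ω₁ ± ω₂`.
* §1 `cover_gauge_equation` (the member equation `Δ^η_{U₀}u + q = D*_{U₀}f` lifted to `F.cover 3` and re-gauged by any `σ`: `Δ^η_{Ũ^σ}(Φu˜) + Φq˜ = D*_{Ũ^σ}(Ψf˜)` with the `Ad_σ`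
  isometries of ✓`exists_adIsometries`), the pointwise sup transfers `norm_equiv_adSite_lift_le`, `norm_equiv_adBond_lift_le`, and ★★★ `hax_of_localHolder` — (P1): `RegPr F n K ε₀ U₀`, the
  equation, global sups `M_u, M_q, M_f`, the frozen letter `hHlocV` (constants `Ch, θ₀`) and `48ε₀ ≤ θ₀` ⟹ the letter for `u` with `H := Ch·(M_u + M_f + M_q)`.
* §2 ★★★ `hax_of_etaGradient` — (P2): `RegPr`, `‖(D_{U₀}p)(b)‖ ≤ G` (all bonds), `‖p(y)‖ ≤ M_p` ⟹ the letter for `p` with `H := 3√10·(G + 2√2·(48ε₀)·M_p)` (indeed for ALL pairs of the ball).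
HYP-SAT (★★OWNER RULING №42).  `RegPr` = print's (8); the equation∕sup rows are H-road objects (at `u := w = G_1D*_Vx`: `q := w`, `f := x`, sups = `hWsup`∕`‖A‖`); the letter `hHlocV` is
print's (3.43) in LOCAL form ([Balaban1985BackgroundPropagators] Thm 3.1), INHABITED at the flat background by ✓`exists_localHolder_flat_member` and DISPLAYED (H2-LOC C1–C5 supply it); the
gradient letter of §2 is the (c2)∕(c2b)∕T1-class sup gradient row.  Conclusions = BRIDGE v2's `hax` text.  HONEST SCOPE: plumbing (lift, gauge, triangle inequalities); no estimate of print is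
proved here; `hHlocV`, `hWsup`, H2, `h3`, norm_G, EX, 19200 NOT proved; the Yang–Mills mass gap is NOT proved.

References: T. Bałaban, CMP **99** (1985) 389–434 [Balaban1985BackgroundPropagators] ((3.3) p.391, (3.8) p.392, (3.23) p.394, p.393, Thm 3.1 (3.43) p.398, (3.35) p.396); CMP **98** (1985) 17–51
[Balaban1985Averaging] ((8)–(9) pp.18–19, (18) p.21, pp.24–25); CMP **96** (1984) 223–250 [Balaban1984PropagatorsII] ((1.9) p.226, (2.15) p.225); CMP **102** (1985) 277–309 [Balaban1985Variational] ((8) p.278).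
-/

set_option autoImplicit false

noncomputable section

open scoped BigOperators Matrix.Norms.L2Operator InnerProductSpace ComplexConjugate

namespace Summit.QuantumFields.YangMills.Theorems.Prop7LocalHolderToAxialLetter

open Literature.MathematicalPhysics.QuantumFieldTheory.Balaban1983to89
open Literature.MathematicalPhysics.QuantumFieldTheory.Balaban1983to89.T3ContinuumYM3Torus
open B10Eq27TorusAxialLog (axialT)
open B4Sect5Torus (TSite tdist tdist_triangle tdist_symm tdist_nonneg)
open B9SectCLatticeCarrier (Bond shift)
open B9Eq311L2Pairing (WL2)
open B11Eq103H1Complex (SiteL2K BondL2K)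
open T3PrintedRegularMinimiser (RegPr)
open T3SectALandauChart (eta eta_pos)
open Summit.QuantumFields.YangMills.Theorems.Prop7SectET3Transport (periodsT3 siteEquiv bondEquiv bgOfCfg)
open Summit.QuantumFields.YangMills.Theorems.Prop7SectET3HilbertLetters (W₂ frobEquiv toL2 toL2S DL2 DstarL2 covLapSite adBg toL2_symm_apply toL2_apply toL2S_apply toL2S_symm_apply)
open Summit.QuantumFields.YangMills.Theorems.Prop7GaugeCovariancePointwise (norm_frobEquiv_symm_conj_eq)
open Summit.QuantumFields.YangMills.Theorems.Prop7TwoBackgroundGradientComparison (one_le_periodsT3 norm_inv_eta equiv_DL2_apply)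
open Summit.QuantumFields.YangMills.Theorems.Prop7LocalLaplacianGaugeCovariance (exists_adIsometries)
open Summit.QuantumFields.YangMills.Theorems.Prop7CurvedMemberLocalGradient (holder_of_eta_gradient)
open Summit.QuantumFields.YangMills.Theorems.Prop7SolutionHessianSupAllMembers (equiv_DL2_cover_bondEquiv)
open Summit.QuantumFields.YangMills.Theorems.Prop7LocalAxialGaugeSmallField (norm_bgOfCfg_gaugeAct_axialT_sub_one_le_cover)
open Summit.QuantumFields.YangMills.Theorems.Prop7TransporterRowsOnBall (hRε_axialGauge_cover)
open Summit.QuantumFields.YangMills.Theorems.CoverSites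
open Summit.QuantumFields.YangMills.Theorems.Prop7CoverHilbertPullback (covLapSite_cover DstarL2_cover')

variable (F : T3Family) (n K : ℕ) (c₀ : ℝ) [Fact (0 < c₀)]

/-! ## §0 (P0) The letter is additive in the field -/

omit [Fact (0 < c₀)] in
/-- **`T[ω₁ + ω₂] = T[ω₁] + T[ω₂]`** — the transported, lifted field is linear in the member field (conjugation and `toL2S` are linear). [cite: Balaban1985BackgroundPropagators, (3.11) p.392] -/
theorem transported_add (σ : GaugeTransf ((F.cover 3).P K) 0 (Matrix.specialUnitaryGroup (Fin 2) ℂ)) (ω₁ ω₂ : SiteL2K ℂ 3 (periodsT3 F K) c₀ W₂) :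
    toL2S (F.cover 3) K c₀ (fun zt => ((σ zt : Matrix.specialUnitaryGroup (Fin 2) ℂ) : Matrix (Fin 2) (Fin 2) ℂ) * (toL2S F K c₀).symm (ω₁ + ω₂) (proj (F.P K) 3 0 zt)
        * star ((σ zt : Matrix.specialUnitaryGroup (Fin 2) ℂ) : Matrix (Fin 2) (Fin 2) ℂ))
      = toL2S (F.cover 3) K c₀ (fun zt => ((σ zt : Matrix.specialUnitaryGroup (Fin 2) ℂ) : Matrix (Fin 2) (Fin 2) ℂ) * (toL2S F K c₀).symm ω₁ (proj (F.P K) 3 0 zt)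
          * star ((σ zt : Matrix.specialUnitaryGroup (Fin 2) ℂ) : Matrix (Fin 2) (Fin 2) ℂ))
        + toL2S (F.cover 3) K c₀ (fun zt => ((σ zt : Matrix.specialUnitaryGroup (Fin 2) ℂ) : Matrix (Fin 2) (Fin 2) ℂ) * (toL2S F K c₀).symm ω₂ (proj (F.P K) 3 0 zt)
          * star ((σ zt : Matrix.specialUnitaryGroup (Fin 2) ℂ) : Matrix (Fin 2) (Fin 2) ℂ)) := by
  rw [← map_add]; congr 1; funext zt
  rw [map_add, Pi.add_apply, Pi.add_apply, mul_add, add_mul]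

omit [Fact (0 < c₀)] in
/-- **`T[ω₁ − ω₂] = T[ω₁] − T[ω₂]`**. [cite: Balaban1985BackgroundPropagators, (3.11) p.392] -/
theorem transported_sub (σ : GaugeTransf ((F.cover 3).P K) 0 (Matrix.specialUnitaryGroup (Fin 2) ℂ)) (ω₁ ω₂ : SiteL2K ℂ 3 (periodsT3 F K) c₀ W₂) :
    toL2S (F.cover 3) K c₀ (fun zt => ((σ zt : Matrix.specialUnitaryGroup (Fin 2) ℂ) : Matrix (Fin 2) (Fin 2) ℂ) * (toL2S F K c₀).symm (ω₁ - ω₂) (proj (F.P K) 3 0 zt)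
        * star ((σ zt : Matrix.specialUnitaryGroup (Fin 2) ℂ) : Matrix (Fin 2) (Fin 2) ℂ))
      = toL2S (F.cover 3) K c₀ (fun zt => ((σ zt : Matrix.specialUnitaryGroup (Fin 2) ℂ) : Matrix (Fin 2) (Fin 2) ℂ) * (toL2S F K c₀).symm ω₁ (proj (F.P K) 3 0 zt)
          * star ((σ zt : Matrix.specialUnitaryGroup (Fin 2) ℂ) : Matrix (Fin 2) (Fin 2) ℂ))
        - toL2S (F.cover 3) K c₀ (fun zt => ((σ zt : Matrix.specialUnitaryGroup (Fin 2) ℂ) : Matrix (Fin 2) (Fin 2) ℂ) * (toL2S F K c₀).symm ω₂ (proj (F.P K) 3 0 zt)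
          * star ((σ zt : Matrix.specialUnitaryGroup (Fin 2) ℂ) : Matrix (Fin 2) (Fin 2) ℂ)) := by
  rw [← map_sub]; congr 1; funext zt
  rw [map_sub, Pi.sub_apply, Pi.sub_apply, mul_sub, sub_mul]

omit [Fact (0 < c₀)] in
/-- ★ **(P0) THE LETTER ADDS**: the windowed cover-axial ½-Hölder letter with constant `H₁` for `ω₁` and `H₂` for `ω₂` gives it with `H₁ + H₂` for `ω₁ + ω₂`.
[cite: Balaban1985BackgroundPropagators, Thm 3.1 (3.43) p.398] -/
theorem hax_add (U₀ : GaugeField (F.P K) 0 (Matrix.specialUnitaryGroup (Fin 2) ℂ)) (ω₁ ω₂ : SiteL2K ℂ 3 (periodsT3 F K) c₀ W₂) {H₁ H₂ : ℝ}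
    (h₁ : ∀ (ct : Site ((F.cover 3).P K) 0) (yt yt' : TSite 3 (periodsT3 (F.cover 3) K)),
      tdist (periodsT3 (F.cover 3) K) (siteEquiv (F.cover 3) K ct) yt ≤ 4 * (F.L : ℝ) ^ (K - n) + 1 →
      tdist (periodsT3 (F.cover 3) K) (siteEquiv (F.cover 3) K ct) yt' ≤ 4 * (F.L : ℝ) ^ (K - n) + 1 →
      tdist (periodsT3 (F.cover 3) K) yt yt' ≤ (F.L : ℝ) ^ (K - n) →
      ‖WL2.equiv ℂ (fun _ : TSite 3 (periodsT3 (F.cover 3) K) => c₀) W₂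
            (toL2S (F.cover 3) K c₀ (fun zt => ((axialT (U₀ ∘ projBond (F.P K) 3 0) ct zt : Matrix.specialUnitaryGroup (Fin 2) ℂ) : Matrix (Fin 2) (Fin 2) ℂ)
              * (toL2S F K c₀).symm ω₁ (proj (F.P K) 3 0 zt) * star ((axialT (U₀ ∘ projBond (F.P K) 3 0) ct zt : Matrix.specialUnitaryGroup (Fin 2) ℂ) : Matrix (Fin 2) (Fin 2) ℂ))) yt'
          - WL2.equiv ℂ (fun _ : TSite 3 (periodsT3 (F.cover 3) K) => c₀) W₂
            (toL2S (F.cover 3) K c₀ (fun zt => ((axialT (U₀ ∘ projBond (F.P K) 3 0) ct zt : Matrix.specialUnitaryGroup (Fin 2) ℂ) : Matrix (Fin 2) (Fin 2) ℂ)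
              * (toL2S F K c₀).symm ω₁ (proj (F.P K) 3 0 zt) * star ((axialT (U₀ ∘ projBond (F.P K) 3 0) ct zt : Matrix.specialUnitaryGroup (Fin 2) ℂ) : Matrix (Fin 2) (Fin 2) ℂ))) yt‖
        ≤ H₁ * (tdist (periodsT3 (F.cover 3) K) yt yt' / ((F.L : ℝ) ^ (K - n))) ^ ((1 : ℝ) / 2))
    (h₂ : ∀ (ct : Site ((F.cover 3).P K) 0) (yt yt' : TSite 3 (periodsT3 (F.cover 3) K)),
      tdist (periodsT3 (F.cover 3) K) (siteEquiv (F.cover 3) K ct) yt ≤ 4 * (F.L : ℝ) ^ (K - n) + 1 →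
      tdist (periodsT3 (F.cover 3) K) (siteEquiv (F.cover 3) K ct) yt' ≤ 4 * (F.L : ℝ) ^ (K - n) + 1 →
      tdist (periodsT3 (F.cover 3) K) yt yt' ≤ (F.L : ℝ) ^ (K - n) →
      ‖WL2.equiv ℂ (fun _ : TSite 3 (periodsT3 (F.cover 3) K) => c₀) W₂
            (toL2S (F.cover 3) K c₀ (fun zt => ((axialT (U₀ ∘ projBond (F.P K) 3 0) ct zt : Matrix.specialUnitaryGroup (Fin 2) ℂ) : Matrix (Fin 2) (Fin 2) ℂ)
              * (toL2S F K c₀).symm ω₂ (proj (F.P K) 3 0 zt) * star ((axialT (U₀ ∘ projBond (F.P K) 3 0) ct zt : Matrix.specialUnitaryGroup (Fin 2) ℂ) : Matrix (Fin 2) (Fin 2) ℂ))) yt'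
          - WL2.equiv ℂ (fun _ : TSite 3 (periodsT3 (F.cover 3) K) => c₀) W₂
            (toL2S (F.cover 3) K c₀ (fun zt => ((axialT (U₀ ∘ projBond (F.P K) 3 0) ct zt : Matrix.specialUnitaryGroup (Fin 2) ℂ) : Matrix (Fin 2) (Fin 2) ℂ)
              * (toL2S F K c₀).symm ω₂ (proj (F.P K) 3 0 zt) * star ((axialT (U₀ ∘ projBond (F.P K) 3 0) ct zt : Matrix.specialUnitaryGroup (Fin 2) ℂ) : Matrix (Fin 2) (Fin 2) ℂ))) yt‖
        ≤ H₂ * (tdist (periodsT3 (F.cover 3) K) yt yt' / ((F.L : ℝ) ^ (K - n))) ^ ((1 : ℝ) / 2)) :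
    ∀ (ct : Site ((F.cover 3).P K) 0) (yt yt' : TSite 3 (periodsT3 (F.cover 3) K)),
      tdist (periodsT3 (F.cover 3) K) (siteEquiv (F.cover 3) K ct) yt ≤ 4 * (F.L : ℝ) ^ (K - n) + 1 →
      tdist (periodsT3 (F.cover 3) K) (siteEquiv (F.cover 3) K ct) yt' ≤ 4 * (F.L : ℝ) ^ (K - n) + 1 →
      tdist (periodsT3 (F.cover 3) K) yt yt' ≤ (F.L : ℝ) ^ (K - n) →
      ‖WL2.equiv ℂ (fun _ : TSite 3 (periodsT3 (F.cover 3) K) => c₀) W₂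
            (toL2S (F.cover 3) K c₀ (fun zt => ((axialT (U₀ ∘ projBond (F.P K) 3 0) ct zt : Matrix.specialUnitaryGroup (Fin 2) ℂ) : Matrix (Fin 2) (Fin 2) ℂ)
              * (toL2S F K c₀).symm (ω₁ + ω₂) (proj (F.P K) 3 0 zt) * star ((axialT (U₀ ∘ projBond (F.P K) 3 0) ct zt : Matrix.specialUnitaryGroup (Fin 2) ℂ) : Matrix (Fin 2) (Fin 2) ℂ))) yt'
          - WL2.equiv ℂ (fun _ : TSite 3 (periodsT3 (F.cover 3) K) => c₀) W₂
            (toL2S (F.cover 3) K c₀ (fun zt => ((axialT (U₀ ∘ projBond (F.P K) 3 0) ct zt : Matrix.specialUnitaryGroup (Fin 2) ℂ) : Matrix (Fin 2) (Fin 2) ℂ)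
              * (toL2S F K c₀).symm (ω₁ + ω₂) (proj (F.P K) 3 0 zt) * star ((axialT (U₀ ∘ projBond (F.P K) 3 0) ct zt : Matrix.specialUnitaryGroup (Fin 2) ℂ) : Matrix (Fin 2) (Fin 2) ℂ))) yt‖
        ≤ (H₁ + H₂) * (tdist (periodsT3 (F.cover 3) K) yt yt' / ((F.L : ℝ) ^ (K - n))) ^ ((1 : ℝ) / 2) := by
  intro ct yt yt' hy hy' hw
  rw [transported_add, WL2.equiv_add, Pi.add_apply, Pi.add_apply, add_sub_add_comm, add_mul]
  exact (norm_add_le _ _).trans (add_le_add (h₁ ct yt yt' hy hy' hw) (h₂ ct yt yt' hy hy' hw))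

omit [Fact (0 < c₀)] in
/-- ★ **(P0) THE LETTER SUBTRACTS**: constants `H₁` for `ω₁` and `H₂` for `ω₂` give `H₁ + H₂` for `ω₁ − ω₂` (`T[ω₁ − ω₂] = T[ω₁] − T[ω₂]` and `(a′ − b′) − (a − b) = (a′ − a) − (b′ − b)`).
[cite: Balaban1985BackgroundPropagators, Thm 3.1 (3.43) p.398] -/
theorem hax_sub (U₀ : GaugeField (F.P K) 0 (Matrix.specialUnitaryGroup (Fin 2) ℂ)) (ω₁ ω₂ : SiteL2K ℂ 3 (periodsT3 F K) c₀ W₂) {H₁ H₂ : ℝ}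
    (h₁ : ∀ (ct : Site ((F.cover 3).P K) 0) (yt yt' : TSite 3 (periodsT3 (F.cover 3) K)),
      tdist (periodsT3 (F.cover 3) K) (siteEquiv (F.cover 3) K ct) yt ≤ 4 * (F.L : ℝ) ^ (K - n) + 1 →
      tdist (periodsT3 (F.cover 3) K) (siteEquiv (F.cover 3) K ct) yt' ≤ 4 * (F.L : ℝ) ^ (K - n) + 1 →
      tdist (periodsT3 (F.cover 3) K) yt yt' ≤ (F.L : ℝ) ^ (K - n) →
      ‖WL2.equiv ℂ (fun _ : TSite 3 (periodsT3 (F.cover 3) K) => c₀) W₂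
            (toL2S (F.cover 3) K c₀ (fun zt => ((axialT (U₀ ∘ projBond (F.P K) 3 0) ct zt : Matrix.specialUnitaryGroup (Fin 2) ℂ) : Matrix (Fin 2) (Fin 2) ℂ)
              * (toL2S F K c₀).symm ω₁ (proj (F.P K) 3 0 zt) * star ((axialT (U₀ ∘ projBond (F.P K) 3 0) ct zt : Matrix.specialUnitaryGroup (Fin 2) ℂ) : Matrix (Fin 2) (Fin 2) ℂ))) yt'
          - WL2.equiv ℂ (fun _ : TSite 3 (periodsT3 (F.cover 3) K) => c₀) W₂
            (toL2S (F.cover 3) K c₀ (fun zt => ((axialT (U₀ ∘ projBond (F.P K) 3 0) ct zt : Matrix.specialUnitaryGroup (Fin 2) ℂ) : Matrix (Fin 2) (Fin 2) ℂ)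
              * (toL2S F K c₀).symm ω₁ (proj (F.P K) 3 0 zt) * star ((axialT (U₀ ∘ projBond (F.P K) 3 0) ct zt : Matrix.specialUnitaryGroup (Fin 2) ℂ) : Matrix (Fin 2) (Fin 2) ℂ))) yt‖
        ≤ H₁ * (tdist (periodsT3 (F.cover 3) K) yt yt' / ((F.L : ℝ) ^ (K - n))) ^ ((1 : ℝ) / 2))
    (h₂ : ∀ (ct : Site ((F.cover 3).P K) 0) (yt yt' : TSite 3 (periodsT3 (F.cover 3) K)),
      tdist (periodsT3 (F.cover 3) K) (siteEquiv (F.cover 3) K ct) yt ≤ 4 * (F.L : ℝ) ^ (K - n) + 1 →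
      tdist (periodsT3 (F.cover 3) K) (siteEquiv (F.cover 3) K ct) yt' ≤ 4 * (F.L : ℝ) ^ (K - n) + 1 →
      tdist (periodsT3 (F.cover 3) K) yt yt' ≤ (F.L : ℝ) ^ (K - n) →
      ‖WL2.equiv ℂ (fun _ : TSite 3 (periodsT3 (F.cover 3) K) => c₀) W₂
            (toL2S (F.cover 3) K c₀ (fun zt => ((axialT (U₀ ∘ projBond (F.P K) 3 0) ct zt : Matrix.specialUnitaryGroup (Fin 2) ℂ) : Matrix (Fin 2) (Fin 2) ℂ)
              * (toL2S F K c₀).symm ω₂ (proj (F.P K) 3 0 zt) * star ((axialT (U₀ ∘ projBond (F.P K) 3 0) ct zt : Matrix.specialUnitaryGroup (Fin 2) ℂ) : Matrix (Fin 2) (Fin 2) ℂ))) yt'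
          - WL2.equiv ℂ (fun _ : TSite 3 (periodsT3 (F.cover 3) K) => c₀) W₂
            (toL2S (F.cover 3) K c₀ (fun zt => ((axialT (U₀ ∘ projBond (F.P K) 3 0) ct zt : Matrix.specialUnitaryGroup (Fin 2) ℂ) : Matrix (Fin 2) (Fin 2) ℂ)
              * (toL2S F K c₀).symm ω₂ (proj (F.P K) 3 0 zt) * star ((axialT (U₀ ∘ projBond (F.P K) 3 0) ct zt : Matrix.specialUnitaryGroup (Fin 2) ℂ) : Matrix (Fin 2) (Fin 2) ℂ))) yt‖
        ≤ H₂ * (tdist (periodsT3 (F.cover 3) K) yt yt' / ((F.L : ℝ) ^ (K - n))) ^ ((1 : ℝ) / 2)) :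
    ∀ (ct : Site ((F.cover 3).P K) 0) (yt yt' : TSite 3 (periodsT3 (F.cover 3) K)),
      tdist (periodsT3 (F.cover 3) K) (siteEquiv (F.cover 3) K ct) yt ≤ 4 * (F.L : ℝ) ^ (K - n) + 1 →
      tdist (periodsT3 (F.cover 3) K) (siteEquiv (F.cover 3) K ct) yt' ≤ 4 * (F.L : ℝ) ^ (K - n) + 1 →
      tdist (periodsT3 (F.cover 3) K) yt yt' ≤ (F.L : ℝ) ^ (K - n) →
      ‖WL2.equiv ℂ (fun _ : TSite 3 (periodsT3 (F.cover 3) K) => c₀) W₂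
            (toL2S (F.cover 3) K c₀ (fun zt => ((axialT (U₀ ∘ projBond (F.P K) 3 0) ct zt : Matrix.specialUnitaryGroup (Fin 2) ℂ) : Matrix (Fin 2) (Fin 2) ℂ)
              * (toL2S F K c₀).symm (ω₁ - ω₂) (proj (F.P K) 3 0 zt) * star ((axialT (U₀ ∘ projBond (F.P K) 3 0) ct zt : Matrix.specialUnitaryGroup (Fin 2) ℂ) : Matrix (Fin 2) (Fin 2) ℂ))) yt'
          - WL2.equiv ℂ (fun _ : TSite 3 (periodsT3 (F.cover 3) K) => c₀) W₂
            (toL2S (F.cover 3) K c₀ (fun zt => ((axialT (U₀ ∘ projBond (F.P K) 3 0) ct zt : Matrix.specialUnitaryGroup (Fin 2) ℂ) : Matrix (Fin 2) (Fin 2) ℂ)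
              * (toL2S F K c₀).symm (ω₁ - ω₂) (proj (F.P K) 3 0 zt) * star ((axialT (U₀ ∘ projBond (F.P K) 3 0) ct zt : Matrix.specialUnitaryGroup (Fin 2) ℂ) : Matrix (Fin 2) (Fin 2) ℂ))) yt‖
        ≤ (H₁ + H₂) * (tdist (periodsT3 (F.cover 3) K) yt yt' / ((F.L : ℝ) ^ (K - n))) ^ ((1 : ℝ) / 2) := by
  intro ct yt yt' hy hy' hw
  rw [transported_sub, WL2.equiv_sub, Pi.sub_apply, Pi.sub_apply, sub_sub_sub_comm, add_mul]
  exact (norm_sub_le _ _).trans (add_le_add (h₁ ct yt yt' hy hy' hw) (h₂ ct yt yt' hy hy' hw))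

/-! ## §1 (P1) From the local ½-Hölder schema at the member equation to the letter -/

/-- **THE MEMBER EQUATION LIFTED TO THE COVER AND RE-GAUGED.**  If `Δ^η_{U₀}u + q = D*_{U₀}f` at the member, then for every gauge transformation `σ` of the `L³`-fold cover and the `Ad_σ`
isometries `Φ, Ψ` of ✓`exists_adIsometries` (their formula and intertwining clauses taken as hypotheses): `Δ^η_{(U₀∘π♭)^σ}(Φ ũ) + Φ q̃ = D*_{(U₀∘π♭)^σ}(Ψ f̃)` for the pulled-back fields
`ũ = (u♭ ∘ π)~`, `q̃`, `f̃ = (f♭ ∘ π♭)~` (✓`covLapSite_cover`, ✓`DstarL2_cover'`). [cite: Balaban1985BackgroundPropagators, (3.23) p.394, (3.8) p.392, p.393] -/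
theorem cover_gauge_equation (U₀ : GaugeField (F.P K) 0 (Matrix.specialUnitaryGroup (Fin 2) ℂ))
    (u q : SiteL2K ℂ 3 (periodsT3 F K) c₀ W₂) (f : BondL2K ℂ 3 (periodsT3 F K) c₀ W₂)
    (hEq : covLapSite F n K c₀ U₀ u + q = DstarL2 F n K c₀ U₀ f)
    (σ : GaugeTransf ((F.cover 3).P K) 0 (Matrix.specialUnitaryGroup (Fin 2) ℂ))
    (Φ : SiteL2K ℂ 3 (periodsT3 (F.cover 3) K) c₀ W₂ ≃ₗᵢ[ℂ] SiteL2K ℂ 3 (periodsT3 (F.cover 3) K) c₀ W₂)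
    (Ψ : BondL2K ℂ 3 (periodsT3 (F.cover 3) K) c₀ W₂ ≃ₗᵢ[ℂ] BondL2K ℂ 3 (periodsT3 (F.cover 3) K) c₀ W₂)
    (hΔ : ∀ x, covLapSite (F.cover 3) n K c₀ (GaugeField.gaugeAct σ (U₀ ∘ projBond (F.P K) 3 0)) (Φ x) = Φ (covLapSite (F.cover 3) n K c₀ (U₀ ∘ projBond (F.P K) 3 0) x))
    (hDs : ∀ A, DstarL2 (F.cover 3) n K c₀ (GaugeField.gaugeAct σ (U₀ ∘ projBond (F.P K) 3 0)) (Ψ A) = Φ (DstarL2 (F.cover 3) n K c₀ (U₀ ∘ projBond (F.P K) 3 0) A)) :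
    covLapSite (F.cover 3) n K c₀ (GaugeField.gaugeAct σ (U₀ ∘ projBond (F.P K) 3 0)) (Φ (toL2S (F.cover 3) K c₀ ((toL2S F K c₀).symm u ∘ proj (F.P K) 3 0)))
        + Φ (toL2S (F.cover 3) K c₀ ((toL2S F K c₀).symm q ∘ proj (F.P K) 3 0))
      = DstarL2 (F.cover 3) n K c₀ (GaugeField.gaugeAct σ (U₀ ∘ projBond (F.P K) 3 0)) (Ψ (toL2 (F.cover 3) K c₀ ((toL2 F K c₀).symm f ∘ projBond (F.P K) 3 0))) := by
  -- the lifted equation at the lifted background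
  have hlift : covLapSite (F.cover 3) n K c₀ (U₀ ∘ projBond (F.P K) 3 0) (toL2S (F.cover 3) K c₀ ((toL2S F K c₀).symm u ∘ proj (F.P K) 3 0))
      + toL2S (F.cover 3) K c₀ ((toL2S F K c₀).symm q ∘ proj (F.P K) 3 0)
      = DstarL2 (F.cover 3) n K c₀ (U₀ ∘ projBond (F.P K) 3 0) (toL2 (F.cover 3) K c₀ ((toL2 F K c₀).symm f ∘ projBond (F.P K) 3 0)) := by
    rw [covLapSite_cover F 3 n K c₀ U₀, DstarL2_cover' F 3 n K c₀ U₀, LinearEquiv.apply_symm_apply, LinearEquiv.apply_symm_apply, ← map_add]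
    congr 1
    funext zt
    simp only [Function.comp_apply, Pi.add_apply, ← hEq, map_add]
  rw [hΔ, hDs, ← hlift, map_add]

omit n in
/-- **SITE SUPS SURVIVE THE LIFT AND THE CONJUGATION**: `‖(Φ ũ)(ỹ)‖ = ‖u(e(π(ẽ⁻¹ỹ)))‖` pointwise, so a member sup `‖u(y)‖ ≤ M` gives `‖(Φ ũ)(ỹ)‖ ≤ M` (✓`norm_frobEquiv_symm_conj_eq`).
[cite: Balaban1985Averaging, (18) p.21] -/
theorem norm_equiv_adSite_lift_le (σ : GaugeTransf ((F.cover 3).P K) 0 (Matrix.specialUnitaryGroup (Fin 2) ℂ))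
    (Φ : SiteL2K ℂ 3 (periodsT3 (F.cover 3) K) c₀ W₂ ≃ₗᵢ[ℂ] SiteL2K ℂ 3 (periodsT3 (F.cover 3) K) c₀ W₂)
    (hΦ : ∀ l : Site ((F.cover 3).P K) 0 → Matrix (Fin 2) (Fin 2) ℂ,
      Φ (toL2S (F.cover 3) K c₀ l) = toL2S (F.cover 3) K c₀ (fun x => (σ x : Matrix (Fin 2) (Fin 2) ℂ) * l x * star (σ x : Matrix (Fin 2) (Fin 2) ℂ)))
    (u : SiteL2K ℂ 3 (periodsT3 F K) c₀ W₂) {M : ℝ} (hM : ∀ y : TSite 3 (periodsT3 F K), ‖WL2.equiv ℂ (fun _ : TSite 3 (periodsT3 F K) => c₀) W₂ u y‖ ≤ M) :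
    ∀ yt : TSite 3 (periodsT3 (F.cover 3) K),
      ‖WL2.equiv ℂ (fun _ : TSite 3 (periodsT3 (F.cover 3) K) => c₀) W₂ (Φ (toL2S (F.cover 3) K c₀ ((toL2S F K c₀).symm u ∘ proj (F.P K) 3 0))) yt‖ ≤ M := by
  intro yt
  rw [hΦ, toL2S_apply, norm_frobEquiv_symm_conj_eq, Function.comp_apply, toL2S_symm_apply, LinearEquiv.symm_apply_apply]
  exact hM _

omit n in
/-- **BOND SUPS SURVIVE THE LIFT AND THE CONJUGATION**: a member sup `‖f(b)‖ ≤ M` gives `‖(Ψ f̃)(b̃)‖ ≤ M` pointwise. [cite: Balaban1985Averaging, (18) p.21] -/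
theorem norm_equiv_adBond_lift_le (σ : GaugeTransf ((F.cover 3).P K) 0 (Matrix.specialUnitaryGroup (Fin 2) ℂ))
    (Ψ : BondL2K ℂ 3 (periodsT3 (F.cover 3) K) c₀ W₂ ≃ₗᵢ[ℂ] BondL2K ℂ 3 (periodsT3 (F.cover 3) K) c₀ W₂)
    (hΨ : ∀ X : PBond ((F.cover 3).P K) 0 → Matrix (Fin 2) (Fin 2) ℂ,
      Ψ (toL2 (F.cover 3) K c₀ X) = toL2 (F.cover 3) K c₀ (fun b => (σ b.src : Matrix (Fin 2) (Fin 2) ℂ) * X b * star (σ b.src : Matrix (Fin 2) (Fin 2) ℂ)))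
    (f : BondL2K ℂ 3 (periodsT3 F K) c₀ W₂) {M : ℝ} (hM : ∀ b : Bond 3 (periodsT3 F K), ‖WL2.equiv ℂ (fun _ : Bond 3 (periodsT3 F K) => c₀) W₂ f b‖ ≤ M) :
    ∀ bt : Bond 3 (periodsT3 (F.cover 3) K),
      ‖WL2.equiv ℂ (fun _ : Bond 3 (periodsT3 (F.cover 3) K) => c₀) W₂ (Ψ (toL2 (F.cover 3) K c₀ ((toL2 F K c₀).symm f ∘ projBond (F.P K) 3 0))) bt‖ ≤ M := by
  intro bt
  rw [hΨ, toL2_apply, norm_frobEquiv_symm_conj_eq, Function.comp_apply, toL2_symm_apply, LinearEquiv.symm_apply_apply]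
  exact hM _

/-- ★★★ **(P1) THE LETTER FROM THE LOCAL ½-HÖLDER SCHEMA AT A MEMBER EQUATION.**  Let `RegPr F n K ε₀ U₀` (`0 ≤ ε₀`), let `u, q, f` satisfy `Δ^η_{U₀}u + q = D*_{U₀}f` at the member with GLOBAL
sups `‖u(y)‖ ≤ M_u`, `‖q(y)‖ ≤ M_q`, `‖f(b)‖ ≤ M_f`, and let the LOCAL ½-Hölder letter `hHlocV` hold with the consumer's constants `Ch`, `θ₀` (px19 g16's FROZEN text `H2LOC-LETTER-hHlocV.px19g16.txt` sha16 857ccd79b0071bdc, RECORD 17dq, BYTE-FOR-BYTE: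
for any background `V`, fields with the equation, sups on the ball `tdist x · ≤ 4ℓ+1`, and `‖V(y,μ) − 1‖ ≤ δ` there with `ℓδ ≤ θ₀` ⟹ `‖u(x′) − u(x)‖ ≤ Ch(M_u + M_f + M_q)(tdist x x′∕ℓ)^{½}` for
`tdist x x′ ≤ ℓ`, at EVERY member), and `48ε₀ ≤ θ₀`.  Then `u` has the windowed cover-axial ½-Hölder letter (BRIDGE v2 `hax`) with `H := Ch·(M_u + M_f + M_q)`.  PROOF: per cover centre `ct`, in the axial
gauge `σ̃ = axialT (U₀∘π♭) ct`: §1's lifted re-gauged equation, the transferred sups, pipeline (i)'s `δ = 48ε₀η` on `tdist (ẽ ct) · ≤ 12ℓ+4 ⊇` the `4ℓ+1`-ball about any `yt` of the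
`4ℓ+1`-ball about `ẽ ct`, `ℓδ = 48ε₀`, and the schema AT CENTRE `x := yt`; `Φ ũ` IS the transported field. [cite: Balaban1985BackgroundPropagators, Thm 3.1 (3.43) p.398, (3.35) p.396, p.393;
Balaban1984PropagatorsII, (1.9) p.226; Balaban1985Averaging, pp.24-25] -/
theorem hax_of_localHolder {Ch θ₀ ε₀ : ℝ} (hε₀ : 0 ≤ ε₀) (hθ : 48 * ε₀ ≤ θ₀)
    (hHlocV : ∀ (F : T3Family) (n K : ℕ) (c₀ : ℝ) [Fact (0 < c₀)] (V : GaugeField (F.P K) 0 (Matrix.specialUnitaryGroup (Fin 2) ℂ))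
      (u q : SiteL2K ℂ 3 (periodsT3 F K) c₀ W₂) (f : BondL2K ℂ 3 (periodsT3 F K) c₀ W₂) (x : TSite 3 (periodsT3 F K)) (Mu Mf Mq δ : ℝ),
      0 ≤ Mu → 0 ≤ Mf → 0 ≤ Mq → 0 ≤ δ → (F.L : ℝ) ^ (K - n) * δ ≤ θ₀ →
      covLapSite F n K c₀ V u + q = DstarL2 F n K c₀ V f →
      (∀ y, tdist (periodsT3 F K) x y ≤ 4 * (F.L : ℝ) ^ (K - n) + 1 → ‖WL2.equiv ℂ (fun _ : TSite 3 (periodsT3 F K) => c₀) W₂ u y‖ ≤ Mu) →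
      (∀ (y : TSite 3 (periodsT3 F K)) (μ : Fin 3), tdist (periodsT3 F K) x y ≤ 4 * (F.L : ℝ) ^ (K - n) + 1 →
        ‖WL2.equiv ℂ (fun _ : Bond 3 (periodsT3 F K) => c₀) W₂ f (y, μ)‖ ≤ Mf) →
      (∀ y, tdist (periodsT3 F K) x y ≤ 4 * (F.L : ℝ) ^ (K - n) + 1 → ‖WL2.equiv ℂ (fun _ : TSite 3 (periodsT3 F K) => c₀) W₂ q y‖ ≤ Mq) →
      (∀ (y : TSite 3 (periodsT3 F K)) (μ : Fin 3), tdist (periodsT3 F K) x y ≤ 4 * (F.L : ℝ) ^ (K - n) + 1 →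
        ‖((bgOfCfg F K V (y, μ) : (Matrix (Fin 2) (Fin 2) ℂ)ˣ) : Matrix (Fin 2) (Fin 2) ℂ) - 1‖ ≤ δ) →
      ∀ x' : TSite 3 (periodsT3 F K), tdist (periodsT3 F K) x x' ≤ (F.L : ℝ) ^ (K - n) →
        ‖WL2.equiv ℂ (fun _ : TSite 3 (periodsT3 F K) => c₀) W₂ u x' - WL2.equiv ℂ (fun _ : TSite 3 (periodsT3 F K) => c₀) W₂ u x‖
          ≤ Ch * (Mu + Mf + Mq) * (tdist (periodsT3 F K) x x' / ((F.L : ℝ) ^ (K - n))) ^ ((1 : ℝ) / 2))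
    (U₀ : GaugeField (F.P K) 0 (Matrix.specialUnitaryGroup (Fin 2) ℂ)) (hreg : RegPr F n K ε₀ U₀)
    (u q : SiteL2K ℂ 3 (periodsT3 F K) c₀ W₂) (f : BondL2K ℂ 3 (periodsT3 F K) c₀ W₂)
    (hEq : covLapSite F n K c₀ U₀ u + q = DstarL2 F n K c₀ U₀ f)
    {Mu Mq Mf : ℝ} (hMu0 : 0 ≤ Mu) (hMq0 : 0 ≤ Mq) (hMf0 : 0 ≤ Mf)
    (hMu : ∀ y : TSite 3 (periodsT3 F K), ‖WL2.equiv ℂ (fun _ : TSite 3 (periodsT3 F K) => c₀) W₂ u y‖ ≤ Mu)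
    (hMq : ∀ y : TSite 3 (periodsT3 F K), ‖WL2.equiv ℂ (fun _ : TSite 3 (periodsT3 F K) => c₀) W₂ q y‖ ≤ Mq)
    (hMf : ∀ b : Bond 3 (periodsT3 F K), ‖WL2.equiv ℂ (fun _ : Bond 3 (periodsT3 F K) => c₀) W₂ f b‖ ≤ Mf) :
    ∀ (ct : Site ((F.cover 3).P K) 0) (yt yt' : TSite 3 (periodsT3 (F.cover 3) K)),
      tdist (periodsT3 (F.cover 3) K) (siteEquiv (F.cover 3) K ct) yt ≤ 4 * (F.L : ℝ) ^ (K - n) + 1 →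
      tdist (periodsT3 (F.cover 3) K) (siteEquiv (F.cover 3) K ct) yt' ≤ 4 * (F.L : ℝ) ^ (K - n) + 1 →
      tdist (periodsT3 (F.cover 3) K) yt yt' ≤ (F.L : ℝ) ^ (K - n) →
      ‖WL2.equiv ℂ (fun _ : TSite 3 (periodsT3 (F.cover 3) K) => c₀) W₂
            (toL2S (F.cover 3) K c₀ (fun zt => ((axialT (U₀ ∘ projBond (F.P K) 3 0) ct zt : Matrix.specialUnitaryGroup (Fin 2) ℂ) : Matrix (Fin 2) (Fin 2) ℂ)
              * (toL2S F K c₀).symm u (proj (F.P K) 3 0 zt) * star ((axialT (U₀ ∘ projBond (F.P K) 3 0) ct zt : Matrix.specialUnitaryGroup (Fin 2) ℂ) : Matrix (Fin 2) (Fin 2) ℂ))) yt'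
          - WL2.equiv ℂ (fun _ : TSite 3 (periodsT3 (F.cover 3) K) => c₀) W₂
            (toL2S (F.cover 3) K c₀ (fun zt => ((axialT (U₀ ∘ projBond (F.P K) 3 0) ct zt : Matrix.specialUnitaryGroup (Fin 2) ℂ) : Matrix (Fin 2) (Fin 2) ℂ)
              * (toL2S F K c₀).symm u (proj (F.P K) 3 0 zt) * star ((axialT (U₀ ∘ projBond (F.P K) 3 0) ct zt : Matrix.specialUnitaryGroup (Fin 2) ℂ) : Matrix (Fin 2) (Fin 2) ℂ))) yt‖
        ≤ (Ch * (Mu + Mf + Mq)) * (tdist (periodsT3 (F.cover 3) K) yt yt' / ((F.L : ℝ) ^ (K - n))) ^ ((1 : ℝ) / 2) := by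
  intro ct yt yt' hy hy' hw
  have hP1 : ∀ i, 1 ≤ periodsT3 (F.cover 3) K i := one_le_periodsT3 (F.cover 3) K
  -- the cover, the axial gauge at the centre, the `Ad` isometries
  set Ut : GaugeField ((F.cover 3).P K) 0 (Matrix.specialUnitaryGroup (Fin 2) ℂ) := U₀ ∘ projBond (F.P K) 3 0 with hUt
  set σ : GaugeTransf ((F.cover 3).P K) 0 (Matrix.specialUnitaryGroup (Fin 2) ℂ) := axialT Ut ct with hσ
  obtain ⟨Φ, Ψ, hΦ, hΨ, hcov⟩ := exists_adIsometries (F.cover 3) n K c₀ σ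
  obtain ⟨_, hDs, hΔ⟩ := hcov Ut
  -- the lifted fields and the re-gauged equation
  set ut : SiteL2K ℂ 3 (periodsT3 (F.cover 3) K) c₀ W₂ := toL2S (F.cover 3) K c₀ ((toL2S F K c₀).symm u ∘ proj (F.P K) 3 0) with hut
  set qt : SiteL2K ℂ 3 (periodsT3 (F.cover 3) K) c₀ W₂ := toL2S (F.cover 3) K c₀ ((toL2S F K c₀).symm q ∘ proj (F.P K) 3 0) with hqt
  set ft : BondL2K ℂ 3 (periodsT3 (F.cover 3) K) c₀ W₂ := toL2 (F.cover 3) K c₀ ((toL2 F K c₀).symm f ∘ projBond (F.P K) 3 0) with hft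
  have hEqt : covLapSite (F.cover 3) n K c₀ (GaugeField.gaugeAct σ Ut) (Φ ut) + Φ qt = DstarL2 (F.cover 3) n K c₀ (GaugeField.gaugeAct σ Ut) (Ψ ft) :=
    cover_gauge_equation F n K c₀ U₀ u q f hEq σ Φ Ψ hΔ hDs
  -- the sups
  have hMut := norm_equiv_adSite_lift_le F K c₀ σ Φ hΦ u hMu
  have hMqt := norm_equiv_adSite_lift_le F K c₀ σ Φ hΦ q hMq
  have hMft := norm_equiv_adBond_lift_le F K c₀ σ Ψ hΨ f hMf
  -- the small field on the `4ℓ+1` ball about `yt` (inside the `12ℓ+4` ball about `ẽ ct`)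
  have hδ : ∀ (y : TSite 3 (periodsT3 (F.cover 3) K)) (μ : Fin 3), tdist (periodsT3 (F.cover 3) K) yt y ≤ 4 * (F.L : ℝ) ^ (K - n) + 1 →
      ‖((bgOfCfg (F.cover 3) K (GaugeField.gaugeAct σ Ut) (y, μ) : (Matrix (Fin 2) (Fin 2) ℂ)ˣ) : Matrix (Fin 2) (Fin 2) ℂ) - 1‖ ≤ 48 * ε₀ * eta F n K := by
    intro y μ hyy
    refine norm_bgOfCfg_gaugeAct_axialT_sub_one_le_cover F n K hε₀ U₀ hreg ct y μ ?_
    have ht := tdist_triangle hP1 (siteEquiv (F.cover 3) K ct) yt y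
    have hℓ0 : (0 : ℝ) ≤ (F.L : ℝ) ^ (K - n) := by positivity
    linarith
  have hη : 0 < eta F n K := eta_pos F n K
  have hL0 : (0 : ℝ) < (F.L : ℝ) := by have := F.hL.2; exact_mod_cast (lt_trans zero_lt_one this)
  have hℓδ : (F.L : ℝ) ^ (K - n) * (48 * ε₀ * eta F n K) ≤ θ₀ := by
    have hℓη : (F.L : ℝ) ^ (K - n) * eta F n K = 1 := by
      unfold eta; rw [← mul_pow, mul_inv_cancel₀ hL0.ne', one_pow]
    calc (F.L : ℝ) ^ (K - n) * (48 * ε₀ * eta F n K) = 48 * ε₀ * ((F.L : ℝ) ^ (K - n) * eta F n K) := by ring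
      _ ≤ θ₀ := by rw [hℓη, mul_one]; exact hθ
  -- the schema at centre `yt`
  have h := hHlocV (F.cover 3) n K c₀ (GaugeField.gaugeAct σ Ut) (Φ ut) (Φ qt) (Ψ ft) yt Mu Mf Mq (48 * ε₀ * eta F n K) hMu0 hMf0 hMq0 (by positivity) hℓδ hEqt
    (fun y _ => hMut y) (fun y μ _ => hMft (y, μ)) (fun y _ => hMqt y) hδ yt' hw
  -- `Φ ũ` is the transported field
  rw [hut, hΦ] at h
  exact h

/-! ## §2 (P2) From a covariant η-gradient sup letter to the letter -/

/-- ★★★ **(P2) THE LETTER FROM A COVARIANT η-GRADIENT SUP LETTER.**  Let `RegPr F n K ε₀ U₀` (`0 ≤ ε₀`) and let the member field `p` have `‖(D_{U₀}p)(b)‖ ≤ G` for every bond (`0 ≤ G`;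
the η-covariant derivative (3.3), sup in the `W₂` fibre) and `‖p(y)‖ ≤ M_p`.  Then `p` has the windowed cover-axial ½-Hölder letter with `H := 3√10·(G + 2√2·(48ε₀)·M_p)` — indeed for ALL
pairs of each `4ℓ+1` ball.  PROOF: on the cover in the axial gauge `σ̃` the gradient letter survives (`D_{Ũ^σ̃}Φ = ΨD_Ũ`, ✓`equiv_DL2_cover_bondEquiv`, pointwise isometries); by the stencil
✓`equiv_DL2_apply`, `p̃(y+e_μ) − p̃(y) = [Ad Ṽ(y,μ) p̃(y+e_μ) − p̃(y)] − [Ad Ṽ(y,μ) − 1]p̃(y+e_μ)`, so `ℓ‖p̃(y+e_μ) − p̃(y)‖ ≤ G + ℓ·2√2·48ε₀η·M_p` on the `12ℓ+3` ball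
(✓`hRε_axialGauge_cover`, `‖η⁻¹‖ = ℓ` ✓`norm_inv_eta`, `ℓη = 1`); then ✓`holder_of_eta_gradient` on the cover. [cite: Balaban1985BackgroundPropagators, (3.3) p.391, (3.40) p.397, Thm 3.1
(3.43) p.398, (3.35) p.396; Balaban1985Averaging, pp.24-25] -/
theorem hax_of_etaGradient {ε₀ : ℝ} (hε₀ : 0 ≤ ε₀)
    (U₀ : GaugeField (F.P K) 0 (Matrix.specialUnitaryGroup (Fin 2) ℂ)) (hreg : RegPr F n K ε₀ U₀)
    (p : SiteL2K ℂ 3 (periodsT3 F K) c₀ W₂) {G Mp : ℝ} (hG0 : 0 ≤ G) (hMp0 : 0 ≤ Mp)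
    (hG : ∀ b : Bond 3 (periodsT3 F K), ‖WL2.equiv ℂ (fun _ : Bond 3 (periodsT3 F K) => c₀) W₂ (DL2 F n K c₀ U₀ p) b‖ ≤ G)
    (hMp : ∀ y : TSite 3 (periodsT3 F K), ‖WL2.equiv ℂ (fun _ : TSite 3 (periodsT3 F K) => c₀) W₂ p y‖ ≤ Mp) :
    ∀ (ct : Site ((F.cover 3).P K) 0) (yt yt' : TSite 3 (periodsT3 (F.cover 3) K)),
      tdist (periodsT3 (F.cover 3) K) (siteEquiv (F.cover 3) K ct) yt ≤ 4 * (F.L : ℝ) ^ (K - n) + 1 →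
      tdist (periodsT3 (F.cover 3) K) (siteEquiv (F.cover 3) K ct) yt' ≤ 4 * (F.L : ℝ) ^ (K - n) + 1 →
      tdist (periodsT3 (F.cover 3) K) yt yt' ≤ (F.L : ℝ) ^ (K - n) →
      ‖WL2.equiv ℂ (fun _ : TSite 3 (periodsT3 (F.cover 3) K) => c₀) W₂
            (toL2S (F.cover 3) K c₀ (fun zt => ((axialT (U₀ ∘ projBond (F.P K) 3 0) ct zt : Matrix.specialUnitaryGroup (Fin 2) ℂ) : Matrix (Fin 2) (Fin 2) ℂ)
              * (toL2S F K c₀).symm p (proj (F.P K) 3 0 zt) * star ((axialT (U₀ ∘ projBond (F.P K) 3 0) ct zt : Matrix.specialUnitaryGroup (Fin 2) ℂ) : Matrix (Fin 2) (Fin 2) ℂ))) yt'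
          - WL2.equiv ℂ (fun _ : TSite 3 (periodsT3 (F.cover 3) K) => c₀) W₂
            (toL2S (F.cover 3) K c₀ (fun zt => ((axialT (U₀ ∘ projBond (F.P K) 3 0) ct zt : Matrix.specialUnitaryGroup (Fin 2) ℂ) : Matrix (Fin 2) (Fin 2) ℂ)
              * (toL2S F K c₀).symm p (proj (F.P K) 3 0 zt) * star ((axialT (U₀ ∘ projBond (F.P K) 3 0) ct zt : Matrix.specialUnitaryGroup (Fin 2) ℂ) : Matrix (Fin 2) (Fin 2) ℂ))) yt‖
        ≤ (3 * Real.sqrt 10 * (G + 2 * Real.sqrt 2 * (48 * ε₀) * Mp)) * (tdist (periodsT3 (F.cover 3) K) yt yt' / ((F.L : ℝ) ^ (K - n))) ^ ((1 : ℝ) / 2) := by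
  intro ct yt yt' hy hy' _
  -- the cover, the axial gauge at the centre, the `Ad` isometries
  set Ut : GaugeField ((F.cover 3).P K) 0 (Matrix.specialUnitaryGroup (Fin 2) ℂ) := U₀ ∘ projBond (F.P K) 3 0 with hUt
  set σ : GaugeTransf ((F.cover 3).P K) 0 (Matrix.specialUnitaryGroup (Fin 2) ℂ) := axialT Ut ct with hσ
  obtain ⟨Φ, Ψ, hΦ, hΨ, hcov⟩ := exists_adIsometries (F.cover 3) n K c₀ σ
  obtain ⟨hD, _, _⟩ := hcov Ut
  set lp : Site (F.P K) 0 → Matrix (Fin 2) (Fin 2) ℂ := (toL2S F K c₀).symm p with hlp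
  set pt : SiteL2K ℂ 3 (periodsT3 (F.cover 3) K) c₀ W₂ := toL2S (F.cover 3) K c₀ (lp ∘ proj (F.P K) 3 0) with hpt
  set V : GaugeField ((F.cover 3).P K) 0 (Matrix.specialUnitaryGroup (Fin 2) ℂ) := GaugeField.gaugeAct σ Ut with hV
  -- the transported field `p̃ := Φ pt` and its sup
  have hptΦ : Φ pt = toL2S (F.cover 3) K c₀ (fun zt => ((σ zt : Matrix.specialUnitaryGroup (Fin 2) ℂ) : Matrix (Fin 2) (Fin 2) ℂ) * lp (proj (F.P K) 3 0 zt)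
      * star ((σ zt : Matrix.specialUnitaryGroup (Fin 2) ℂ) : Matrix (Fin 2) (Fin 2) ℂ)) := by rw [hpt, hΦ]; rfl
  have hMpt : ∀ y, ‖WL2.equiv ℂ (fun _ : TSite 3 (periodsT3 (F.cover 3) K) => c₀) W₂ (Φ pt) y‖ ≤ Mp := norm_equiv_adSite_lift_le F K c₀ σ Φ hΦ p hMp
  -- the gradient letter survives: `‖(D_V p̃)(b̃)‖ ≤ G`
  have hGt : ∀ bt : Bond 3 (periodsT3 (F.cover 3) K), ‖WL2.equiv ℂ (fun _ : Bond 3 (periodsT3 (F.cover 3) K) => c₀) W₂ (DL2 (F.cover 3) n K c₀ V (Φ pt)) bt‖ ≤ G := by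
    intro bt
    rw [hV, hD pt]
    -- `Ψ` is a pointwise conjugation
    have hq : DL2 (F.cover 3) n K c₀ Ut pt = toL2 (F.cover 3) K c₀ ((toL2 (F.cover 3) K c₀).symm (DL2 (F.cover 3) n K c₀ Ut pt)) := (LinearEquiv.apply_symm_apply _ _).symm
    rw [hq, hΨ, toL2_apply, norm_frobEquiv_symm_conj_eq, toL2_symm_apply, LinearEquiv.symm_apply_apply]
    have h1 := equiv_DL2_cover_bondEquiv F n K c₀ U₀ lp ((bondEquiv (F.cover 3) K).symm bt)
    rw [← hUt] at h1
    have hl : toL2S F K c₀ lp = p := LinearEquiv.apply_symm_apply _ _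
    rw [hpt, h1, hl]
    exact hG _
  -- the plain η-difference on the `12ℓ+3` ball
  have hη : 0 < eta F n K := eta_pos F n K
  have hL0 : (0 : ℝ) < (F.L : ℝ) := by have := F.hL.2; exact_mod_cast (lt_trans zero_lt_one this)
  have hℓη : (F.L : ℝ) ^ (K - n) * eta F n K = 1 := by
    unfold eta; rw [← mul_pow, mul_inv_cancel₀ hL0.ne', one_pow]
  have hstep : ∀ (z : TSite 3 (periodsT3 (F.cover 3) K)) (μ : Fin 3), tdist (periodsT3 (F.cover 3) K) (siteEquiv (F.cover 3) K ct) z ≤ 12 * (F.L : ℝ) ^ (K - n) + 3 →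
      (F.L : ℝ) ^ (K - n) * ‖WL2.equiv ℂ (fun _ : TSite 3 (periodsT3 (F.cover 3) K) => c₀) W₂ (Φ pt) (shift μ z)
        - WL2.equiv ℂ (fun _ : TSite 3 (periodsT3 (F.cover 3) K) => c₀) W₂ (Φ pt) z‖ ≤ G + 2 * Real.sqrt 2 * (48 * ε₀) * Mp := by
    intro z μ hz
    set a : W₂ := WL2.equiv ℂ (fun _ : TSite 3 (periodsT3 (F.cover 3) K) => c₀) W₂ (Φ pt) (shift μ z) with ha
    set b : W₂ := WL2.equiv ℂ (fun _ : TSite 3 (periodsT3 (F.cover 3) K) => c₀) W₂ (Φ pt) z with hb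
    -- the stencil: `ℓ‖Ad V(z,μ) a − b‖ ≤ G`
    have h1 : (F.L : ℝ) ^ (K - n) * ‖adBg (F.cover 3) K V (z, μ) a - b‖ ≤ G := by
      have h := hGt (z, μ)
      rw [equiv_DL2_apply, norm_smul] at h
      have hn : ‖((((eta (F.cover 3) n K : ℝ) : ℂ))⁻¹)‖ = (F.L : ℝ) ^ (K - n) := norm_inv_eta (F.cover 3) n K
      rw [hn] at h
      exact h
    -- the transporter row on the ball: `‖Ad V(z,μ) a − a‖ ≤ 2√2·48ε₀η·‖a‖`
    have h2 : ‖adBg (F.cover 3) K V (z, μ) a - a‖ ≤ (2 * Real.sqrt 2 * (48 * ε₀ * eta F n K)) * ‖a‖ :=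
      hRε_axialGauge_cover F K n hε₀ U₀ hreg ct (z, μ) a (by linarith)
    have h3 : ‖a‖ ≤ Mp := hMpt _
    have hsplit : a - b = (adBg (F.cover 3) K V (z, μ) a - b) - (adBg (F.cover 3) K V (z, μ) a - a) := by abel
    have hℓ0 : (0 : ℝ) ≤ (F.L : ℝ) ^ (K - n) := by positivity
    calc (F.L : ℝ) ^ (K - n) * ‖a - b‖
        ≤ (F.L : ℝ) ^ (K - n) * (‖adBg (F.cover 3) K V (z, μ) a - b‖ + ‖adBg (F.cover 3) K V (z, μ) a - a‖) := by
          rw [hsplit]; exact mul_le_mul_of_nonneg_left (norm_sub_le _ _) hℓ0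
      _ ≤ G + (F.L : ℝ) ^ (K - n) * ((2 * Real.sqrt 2 * (48 * ε₀ * eta F n K)) * Mp) := by
          rw [mul_add]; exact add_le_add h1 (mul_le_mul_of_nonneg_left (h2.trans (mul_le_mul_of_nonneg_left h3 (by positivity))) hℓ0)
      _ = G + 2 * Real.sqrt 2 * (48 * ε₀) * Mp * ((F.L : ℝ) ^ (K - n) * eta F n K) := by ring
      _ = G + 2 * Real.sqrt 2 * (48 * ε₀) * Mp := by rw [hℓη, mul_one]
  -- the lattice-path lemma on the cover
  have h := holder_of_eta_gradient (F.cover 3) n K c₀ (Φ pt) (siteEquiv (F.cover 3) K ct) (by positivity : (0 : ℝ) ≤ G + 2 * Real.sqrt 2 * (48 * ε₀) * Mp) hstep yt yt' hy hy'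
  rw [hptΦ] at h
  exact h

end Summit.QuantumFields.YangMills.Theorems.Prop7LocalHolderToAxialLetter

end
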